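import Summits.PneNP.PneNP.Theorems.SoloBlindTimeConstructible
import Literature.Computability.Complexity.MapFstMachine
import Literature.Computability.Complexity.TM2While
import Literature.Computability.Complexity.CodeFPStrings
import Literature.Computability.Complexity.NPClosureProofs
import Literature.Computability.MetaComplexity.MCSPProofs
import HarnessLib

/-!
# Uniform one-pass streaming algorithms run in polynomial time: `USTREAM S T ⊆ P`

THEOREM C (`SoloBlindTimeConstructible`) proved McKay–Murray–Williams' Theorem 1.3 in the tree:
for every time-constructible `s`, `StreamingLowerBound s → P ≠ NP`, where
`StreamingLowerBound s := ∀ c, MCSP[s] ∉ USTREAM (s(log N)^c + c) (s(log N)^c + c)` over the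
uniform one-pass streaming class `USTREAM` of
`Literature/Computability/MetaComplexity/McKayMurrayWilliams2019/UniformStreaming.lean`.
This file calibrates that hypothesis FROM ABOVE, by the obvious simulation:

* `USim.exists_streamDecider`: a language decided by a uniform streaming algorithm (one TM2 update
  machine, one TM2 report machine, empty initial state) is decided by ONE TM2 machine within
  `p(N + S N' + T N' + T N)` steps (`N' = max N 1`), for a fixed polynomial `p`;
* `USTREAM_subset_P`: if `S` and `T` are polynomially bounded then `USTREAM S T ⊆ P`.

The corollaries (`MCSP[s] ∉ P → StreamingLowerBound s → PneNP`, `MCSP[s] ∈ NP` for size bounds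
computed on codes) are in `SoloBlindStreamingCalibration`.

## The simulation (proof of `USim.exists_streamDecider`)

On input `w` of length `N` the machine writes the loop word `⟨ff, σ = ε, v, |v|, N⟩` where the
*effective input* `v` is `w` itself if `w ≠ ε` and the one-bit word `0` otherwise (so that every
round of the loop performs a genuine update of the streaming algorithm; the dummy round's state is
discarded at the end).  A round of the `while` machine of `TM2While` maps
`⟨flag, σ, b :: rest, N', N⟩ ↦ ⟨⟨N', σ, b⟩, rest, N', N⟩` (on codes), runs the update machine on the
first field (`mapFstAux`, `MapFstMachine.lean`) and rebuilds `⟨[rest = ε], σ', rest, N', N⟩`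
(on codes); after `|v|` rounds the flag is raised and the loop halts with `σ = reach A |v| v`.
A last code stage produces `⟨N, σ⟩` (with `σ := ε` when `N = 0`) and the report machine answers.
All states met are states of actual runs, so their length is at most `S N'`, every update costs
`T N'` steps, and the code stages are polynomial in the word length.

References: D. M. McKay, C. D. Murray, R. R. Williams, *Weak lower bounds on resource-bounded
compression imply strong separations of complexity classes*, STOC 2019, §2 (the streaming model:
"the total time between two next-bit reads is at most `u(n)`") and Thm. 1.3; S. Arora, B. Barak,
*Computational Complexity: A Modern Approach*, 2009, §1.3–1.4 and Def. 1.13 (composition of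
machines; running a machine in a loop; subroutines on a part of the tape; the class `P`).
-/

namespace Summit.PneNP.PneNP.Theorems.SoloBlind

open Computability Polynomial
open Literature.Computability.Complexity
open Literature.Computability.Complexity.CodeFP (natE unE bitE pairE strE pairE_apply
  unE_eq_ones length_unE length_natE_le)
open Literature.Computability.MetaComplexity
open Literature.Computability.MetaComplexity.McKayMurrayWilliams2019

namespace USim

/-! ### Loop words -/

/-- Loop data `⟨σ, rest, N', N⟩`: current state, unread input, effective length, true length.
[folklore] -/
abbrev LD : Type := List Bool × List Bool × ℕ × ℕ

/-- Code of the loop data. [folklore] -/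
abbrev ldE : LD → List Bool := pairE strE (pairE strE (pairE natE natE))

/-- Loop words `⟨flag, σ, rest, N', N⟩`; the flag's first copy is the first symbol. [folklore] -/
abbrev LW : Type := Bool × LD

/-- Code of the loop words. [folklore] -/
abbrev lwE : LW → List Bool := pairE bitE ldE

/-- Continuations `⟨rest, N', N⟩` parked behind the update query. [folklore] -/
abbrev CT : Type := List Bool × ℕ × ℕ

/-- Code of the continuations. [folklore] -/
abbrev ctE : CT → List Bool := pairE strE (pairE natE natE)

/-- The effective input: the empty word is replaced by the one-bit word `0`. [folklore] -/
def eff (w : List Bool) : List Bool := if w = [] then [false] else w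

/-- The effective input is never empty. [folklore] -/
theorem eff_ne_nil (w : List Bool) : eff w ≠ [] := by
  unfold eff; split_ifs <;> simp_all

/-- The effective input has length `max |w| 1`. [folklore] -/
theorem length_eff (w : List Bool) : (eff w).length = max w.length 1 := by
  unfold eff; split_ifs with h
  · subst h; rfl
  · have : 0 < w.length := List.length_pos_iff.mpr h
    rw [Nat.max_eq_left this]

/-- A nonempty word is its own effective input. [folklore] -/
theorem eff_of_ne_nil {w : List Bool} (h : w ≠ []) : eff w = w := if_neg h

/-! ### The four code stages -/

/-- Pre-stage: `w ↦ ⟨ff, ε, v, |v|, |w|⟩` with `v` the effective input. [folklore] -/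
theorem cf_pre : CodeFP strE lwE (fun w => (false, [], eff w, (eff w).length, w.length)) := by
  have heff : CodeFP strE strE eff :=
    (CodeFP.ite CStream.cf_isNil (CodeFP.const strE (eβ := strE) [false]) (CodeFP.id strE)).congr
      fun w => by unfold eff; by_cases h : w = [] <;> simp [h]
  exact ((CodeFP.const _ false).pair ((CodeFP.const strE (eβ := strE) []).pair (heff.pair
    ((CodeFP.strNatLength.comp heff).pair CodeFP.strNatLength)))).congr fun _ => rfl

/-- Round stage a: `⟨flag, σ, rest, N', N⟩ ↦ ⟨⟨N', σ, head rest⟩, tail rest, N', N⟩`. [folklore] -/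
theorem cf_ra : CodeFP lwE (pairE CStream.uE ctE)
    (fun x => ((x.2.2.2.1, x.2.1, x.2.2.1.headD false), (x.2.2.1.tail, x.2.2.2.1, x.2.2.2.2))) := by
  have hσ : CodeFP lwE strE (fun x => x.2.1) := (CodeFP.snd _ _).fst'
  have hr : CodeFP lwE strE (fun x => x.2.2.1) := (CodeFP.snd _ _).snd'.fst'
  have hN' : CodeFP lwE natE (fun x => x.2.2.2.1) := (CodeFP.snd _ _).snd'.snd'.fst'
  have hN : CodeFP lwE natE (fun x => x.2.2.2.2) := (CodeFP.snd _ _).snd'.snd'.snd'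
  have hhd : CodeFP lwE bitE (fun x => x.2.2.1.headD false) :=
    (CodeFP.strGetD.comp ((CodeFP.const _ (0 : ℕ)).pair hr)).congr fun x => by
      cases x.2.2.1 <;> rfl
  have htl : CodeFP lwE strE (fun x => x.2.2.1.tail) :=
    (CodeFP.strDrop.comp ((CodeFP.const _ (1 : ℕ)).pair hr)).congr fun x => by
      simp [List.drop_one]
  exact ((hN'.pair (hσ.pair hhd)).pair (htl.pair (hN'.pair hN))).congr fun _ => rfl

/-- Round stage b: `⟨σ', rest, N', N⟩ ↦ ⟨[rest = ε], σ', rest, N', N⟩`. [folklore] -/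
theorem cf_rb : CodeFP (pairE strE ctE) lwE
    (fun y => (decide (y.2.1 = []), y.1, y.2.1, y.2.2.1, y.2.2.2)) := by
  have hr : CodeFP (pairE strE ctE) strE (fun y => y.2.1) := (CodeFP.snd _ _).fst'
  exact ((CStream.cf_isNil.comp hr).pair (CodeFP.id _)).congr fun _ => rfl

/-- Post-stage: `⟨flag, σ, rest, N', N⟩ ↦ ⟨N, σ⟩`, with `σ := ε` when `N = 0`. [folklore] -/
theorem cf_post : CodeFP lwE (pairE natE strE)
    (fun x => (x.2.2.2.2, if x.2.2.2.2 = 0 then [] else x.2.1)) := by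
  have hσ : CodeFP lwE strE (fun x => x.2.1) := (CodeFP.snd _ _).fst'
  have hN : CodeFP lwE natE (fun x => x.2.2.2.2) := (CodeFP.snd _ _).snd'.snd'.snd'
  have hz : CodeFP lwE bitE (fun x => decide (x.2.2.2.2 = 0)) :=
    CodeFP.natEq.comp (hN.pair (CodeFP.const _ (0 : ℕ)))
  exact (hN.pair (CodeFP.ite hz (CodeFP.const lwE (eβ := strE) []) hσ)).congr fun x => by
    by_cases h : x.2.2.2.2 = 0 <;> simp [h]

/-! ### The orbit of the loop -/

variable (A : StreamingAlgorithm)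

/-- The flag after `i` rounds on effective input `v`: down at the start, then raised iff the
input is exhausted. [folklore] -/
def fl (v : List Bool) : ℕ → Bool
  | 0 => false
  | i + 1 => decide (v.drop (i + 1) = [])

/-- The orbit: after `i` rounds the word is `⟨flag, reach A |v| (v ↾ i), v ⇂ i, |v|, N⟩`.
[folklore] -/
def orbit (v : List Bool) (N : ℕ) (i : ℕ) : List Bool :=
  lwE (fl v i, reach A v.length (v.take i), v.drop i, v.length, N)

/-- The loop word starts with two copies of its flag. [folklore] -/
theorem orbit_eq_cons (v : List Bool) (N i : ℕ) :
    orbit A v N i = fl v i :: fl v i :: false :: true ::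
      ldE (reach A v.length (v.take i), v.drop i, v.length, N) := rfl

/-- Length of a loop word. [folklore] -/
theorem length_lwE (f : Bool) (σ r : List Bool) (N' N : ℕ) :
    (lwE (f, σ, r, N', N)).length =
      2 * σ.length + 2 * r.length + 2 * (natE N').length + (natE N).length + 10 := by
  simp only [pairE_apply, length_boolPair, bitE, List.length_singleton, strE, id]
  omega

/-! ### The loop -/

variable {A}

/-- **The loop machine.** Given the uniform update machine `MU` of `A` (time `T N'` on reached
states at input length `N'`) and the space bound `S`, the `while` machine over the round
`⟨flag, σ, b :: rest, N', N⟩ ↦ ⟨[rest = ε], MU⟨N', σ, b⟩, rest, N', N⟩` maps the initial loop word of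
a nonempty effective input `v` to the final one within `q(|v| + S |v| + T |v| + |bin |v|| + |bin N|)`
steps, for a fixed polynomial `q`.
[cite: AroraBarak2009, §1.3–1.4 (composition; running a machine in a loop; subroutine on a field)] -/
theorem exists_loopMachine {S T : ℕ → ℕ} (hS : RunsInSpace A S)
    {MU : Turing.TM2ComputableAux Bool Bool}
    (hU : ∀ (N : ℕ) (x : List Bool) (b : Bool), x.length < N →
      MU.OutputsWithin (boolPair (encodeNat N) (boolPair (reach A N x) [b]))
        (reach A N (x ++ [b])) (T N)) :
    ∃ (ML : Turing.TM2ComputableAux Bool Bool) (q : Polynomial ℕ),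
      ∀ (v : List Bool) (N n : ℕ), v.length = n + 1 →
        ML.OutputsWithin (orbit A v N 0) (orbit A v N (n + 1))
          (q.eval (v.length + S v.length + T v.length + (natE v.length).length
            + (natE N).length)) := by
  obtain ⟨pa, Ma, ha⟩ := cf_ra.polyTimeComputable
  obtain ⟨pb, Mb, hb⟩ := cf_rb.polyTimeComputable
  refine ⟨TM2While.whileAux ((Ma.comp (mapFstAux MU)).comp Mb) (fun a : Bool => a),
    X * (pa.comp (2 * X + 10) + pb.comp (2 * X + 10) + 20 * X + 60), fun v N n hn => ?_⟩
  set Q := v.length + S v.length + T v.length + (natE v.length).length + (natE N).length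
    with hQ
  set R := pa.eval (2 * Q + 10) + pb.eval (2 * Q + 10) + 16 * Q + 38 with hR
  have hσ : ∀ i, (reach A v.length (v.take i)).length ≤ S v.length := fun i =>
    hS v.length (v.take i) (by rw [List.length_take]; omega)
  have hol : ∀ i, (orbit A v N i).length ≤ 2 * Q + 10 := fun i => by
    rw [orbit, length_lwE]
    have h1 := hσ i
    have h2 : (v.drop i).length ≤ v.length := by rw [List.length_drop]; omega
    omega
  -- one round: stage a on codes, the update machine on the first field, stage b on codes
  have hround : ∀ i < v.length, ((Ma.comp (mapFstAux MU)).comp Mb).OutputsWithin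
      (orbit A v N i) (orbit A v N (i + 1)) R := by
    intro i hi
    have hdrop : v.drop i = v[i] :: v.drop (i + 1) := List.drop_eq_getElem_cons hi
    have htake : v.take (i + 1) = v.take i ++ [v[i]] := List.take_succ_eq_append_getElem hi
    have Ha : Ma.OutputsWithin (orbit A v N i)
        (pairE CStream.uE ctE ((v.length, reach A v.length (v.take i), (v.drop i).headD false),
          ((v.drop i).tail, v.length, N)))
        (pa.eval (orbit A v N i).length) :=
      ha (fl v i, reach A v.length (v.take i), v.drop i, v.length, N)
    rw [hdrop, List.headD_cons, List.tail_cons] at Ha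
    have HU : MU.OutputsWithin
        (boolUnpair (pairE CStream.uE ctE ((v.length, reach A v.length (v.take i), v[i]),
          (v.drop (i + 1), v.length, N)))).1
        (reach A v.length (v.take (i + 1))) (T v.length) := by
      rw [pairE_apply, boolUnpair_boolPair, htake]
      exact hU v.length (v.take i) v[i] (by rw [List.length_take]; omega)
    have Hm := outputsWithin_mapFstAux MU HU
    rw [show PairFstTM.readRest (pairE CStream.uE ctE ((v.length, reach A v.length (v.take i), v[i]),
        (v.drop (i + 1), v.length, N))) = ctE (v.drop (i + 1), v.length, N) by
      rw [pairE_apply, readRest_boolPair]] at Hm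
    have Hb : Mb.OutputsWithin
        (boolPair (reach A v.length (v.take (i + 1))) (ctE (v.drop (i + 1), v.length, N)))
        (orbit A v N (i + 1))
        (pb.eval (boolPair (reach A v.length (v.take (i + 1)))
          (ctE (v.drop (i + 1), v.length, N))).length) :=
      hb (reach A v.length (v.take (i + 1)), (v.drop (i + 1), v.length, N))
    have H := Turing.TM2ComputableAux.comp_outputsWithin _ _
      (Turing.TM2ComputableAux.comp_outputsWithin _ _ Ha Hm) Hb
    refine H.mono ?_
    have h1 := TM2Iter.eval_mono pa (hol i)
    have h2 := hσ (i + 1)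
    have h3 : (v.drop (i + 1)).length ≤ v.length := by rw [List.length_drop]; omega
    have h4 := hσ i
    have hz : (pairE CStream.uE ctE ((v.length, reach A v.length (v.take i), v[i]),
        (v.drop (i + 1), v.length, N))).length ≤ 6 * Q + 16 := by
      simp only [pairE_apply, length_boolPair, bitE, List.length_singleton, strE, id]
      omega
    have hy : (boolPair (reach A v.length (v.take (i + 1)))
        (ctE (v.drop (i + 1), v.length, N))).length ≤ 2 * Q + 10 := by
      simp only [pairE_apply, length_boolPair, strE, id]
      omega
    have h5 := TM2Iter.eval_mono pb hy
    omega
  -- the loop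
  have hrun : ∀ i ≤ n, ((Ma.comp (mapFstAux MU)).comp Mb).OutputsWithin
      (orbit A v N i) (orbit A v N (i + 1)) R := fun i hi => hround i (by omega)
  have hgo : ∀ i < n, ∃ a rest, orbit A v N (i + 1) = a :: rest ∧ (fun a : Bool => a) a = false :=
    fun i hi => ⟨_, _, orbit_eq_cons A v N (i + 1), by
      have : ¬ v.length ≤ i + 1 := by omega
      simpa [fl] using this⟩
  have hstop : ∃ a rest, orbit A v N (n + 1) = a :: rest ∧ (fun a : Bool => a) a = true :=
    ⟨_, _, orbit_eq_cons A v N (n + 1), by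
      have : v.length ≤ n + 1 := by omega
      simpa [fl] using this⟩
  have HL := TM2While.whileAux_outputsWithin ((Ma.comp (mapFstAux MU)).comp Mb)
    (fun a : Bool => a) n (orbit A v N) (fun _ => R) hrun hgo hstop
  refine HL.mono ?_
  have hsum : ∑ i ∈ Finset.range (n + 1), (R + 2 * (orbit A v N (i + 1)).length + 2)
      ≤ (n + 1) * (R + 4 * Q + 22) := by
    have h := Finset.sum_le_card_nsmul (Finset.range (n + 1))
      (fun i => R + 2 * (orbit A v N (i + 1)).length + 2) (R + 4 * Q + 22)
      (fun i _ => by have := hol (i + 1); omega)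
    simpa using h
  have hq : (X * (pa.comp (2 * X + 10) + pb.comp (2 * X + 10) + 20 * X + 60) : Polynomial ℕ).eval Q
      = Q * (R + 4 * Q + 22) := by
    rw [hR]
    simp only [eval_mul, eval_add, eval_comp, eval_X, eval_ofNat]
    ring
  rw [hq]
  exact hsum.trans (Nat.mul_le_mul_right _ (by omega))

/-! ### The decider -/

/-- **A uniform streaming algorithm is one polynomial-time machine.** If `A` has empty initial
states, runs in space `S`, and has uniform update and report time `T`, then ONE `TM2` machine
outputs `[A.accept |w| (A.finalState w)]` on every input `w` within
`p(|w| + S |v| + T |v| + T |w|)` steps (`v` the effective input, `|v| = max |w| 1`), for a fixed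
polynomial `p`. [cite: AroraBarak2009, §1.3–1.4 (composition of machines; loops)] -/
theorem exists_streamDecider (h0 : ∀ N, A.init N = []) {S T : ℕ → ℕ} (hS : RunsInSpace A S)
    (hU : HasUniformUpdateTime A T) (hR : HasUniformReportTime A T) :
    ∃ (M : Turing.TM2ComputableAux Bool Bool) (p : Polynomial ℕ), ∀ w : List Bool,
      M.OutputsWithin w [A.accept w.length (A.finalState w)]
        (p.eval (w.length + S (eff w).length + T (eff w).length + T w.length)) := by
  obtain ⟨MU, hMU⟩ := hU
  obtain ⟨MR, hMR⟩ := hR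
  obtain ⟨ML, q, hL⟩ := exists_loopMachine (A := A) hS hMU
  obtain ⟨pp, Mp, hp⟩ := cf_pre.polyTimeComputable
  obtain ⟨pc, Mc, hc⟩ := cf_post.polyTimeComputable
  refine ⟨((Mp.comp ML).comp Mc).comp MR, pp + q.comp (3 * X + 2) + pc.comp (5 * X + 12) + X,
    fun w => ?_⟩
  obtain ⟨n, hn⟩ : ∃ n, (eff w).length = n + 1 :=
    ⟨(eff w).length - 1, by have := List.length_pos_iff.mpr (eff_ne_nil w); omega⟩
  -- stage 1: the initial loop word
  have e0 : orbit A (eff w) w.length 0 = lwE (false, [], eff w, (eff w).length, w.length) := by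
    simp only [orbit, fl, List.take_zero, List.drop_zero, reach_nil, h0]
  have H1 : Mp.OutputsWithin w (orbit A (eff w) w.length 0) (pp.eval w.length) := by
    rw [e0]; exact hp w
  -- stage 2: the loop
  have H2 := hL (eff w) w.length n hn
  -- stage 3: extract `⟨N, final state⟩`
  have hfin : (if w.length = 0 then [] else reach A (eff w).length ((eff w).take (n + 1)))
      = A.finalState w := by
    by_cases hw : w = []
    · subst hw; simp [finalState_eq_reach, h0]
    · have hn' : w.length = n + 1 := by rw [eff_of_ne_nil hw] at hn; exact hn
      rw [if_neg (by rw [List.length_eq_zero_iff]; exact hw), eff_of_ne_nil hw,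
        finalState_eq_reach, List.take_of_length_le (by omega)]
  have H3 : Mc.OutputsWithin (orbit A (eff w) w.length (n + 1))
      (pairE natE strE (w.length,
        if w.length = 0 then [] else reach A (eff w).length ((eff w).take (n + 1))))
      (pc.eval (orbit A (eff w) w.length (n + 1)).length) :=
    hc (fl (eff w) (n + 1), reach A (eff w).length ((eff w).take (n + 1)),
      (eff w).drop (n + 1), (eff w).length, w.length)
  rw [hfin] at H3
  -- stage 4: report
  have H4 : MR.OutputsWithin (pairE natE strE (w.length, A.finalState w))
      [A.accept w.length (A.finalState w)] (T w.length) := hMR w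
  have H := Turing.TM2ComputableAux.comp_outputsWithin _ _
    (Turing.TM2ComputableAux.comp_outputsWithin _ _
      (Turing.TM2ComputableAux.comp_outputsWithin _ _ H1 H2) H3) H4
  refine H.mono ?_
  -- the time bound
  set U := w.length + S (eff w).length + T (eff w).length + T w.length with hUdef
  have hv : (eff w).length ≤ w.length + 1 := by rw [length_eff]; omega
  have hn1 := length_natE_le (eff w).length
  have hn2 := length_natE_le w.length
  have hQ : (eff w).length + S (eff w).length + T (eff w).length + (natE (eff w).length).length
      + (natE w.length).length ≤ 3 * U + 2 := by omega
  have hlast : (orbit A (eff w) w.length (n + 1)).length ≤ 5 * U + 12 := by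
    rw [orbit, length_lwE]
    have h1 : (reach A (eff w).length ((eff w).take (n + 1))).length ≤ S (eff w).length :=
      hS _ _ (by rw [List.length_take]; omega)
    have h2 : ((eff w).drop (n + 1)).length = 0 := by rw [List.length_drop]; omega
    omega
  have e : (pp + q.comp (3 * X + 2) + pc.comp (5 * X + 12) + X : Polynomial ℕ).eval U
      = pp.eval U + q.eval (3 * U + 2) + pc.eval (5 * U + 12) + U := by
    simp only [eval_add, eval_comp, eval_mul, eval_X, eval_ofNat]
  rw [e]
  have e1 := TM2Iter.eval_mono pp (show w.length ≤ U by omega)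
  have e2 := TM2Iter.eval_mono q hQ
  have e3 := TM2Iter.eval_mono pc hlast
  omega

end USim

/-! ### `USTREAM ⊆ P` -/

/-- **`USTREAM S T ⊆ P` for polynomially bounded `S` and `T`.** A language decided by a
uniform one-pass streaming algorithm with empty initial states, space `S N ≤ N^k + k` and update /
report time `T N ≤ N^k + k` is in `P`: simulate the stream (`USim.exists_streamDecider`).
[cite: McKayMurrayWilliams2019, §2 (the streaming model); AroraBarak2009, Def. 1.13] -/
theorem USTREAM_subset_P {S T : ℕ → ℕ} {k : ℕ} (hSk : ∀ N, S N ≤ N ^ k + k)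
    (hTk : ∀ N, T N ≤ N ^ k + k) : USTREAM S T ⊆ Classes.P := by
  rintro L ⟨A, h0, hS, hU, hR, hD⟩
  obtain ⟨M, p, hM⟩ := USim.exists_streamDecider (A := A) h0 hS hU hR
  refine (mem_P_iff_holds (L := L)).2 (polyTimeDecidable_iff.2
    ⟨p.comp (X + 3 * ((X + 1) ^ k + Polynomial.C k)), M, fun w => ?_⟩)
  have hacc : A.accept w.length (A.finalState w) = L.boolIndicator w := by
    rw [Bool.eq_iff_iff, ← Set.mem_iff_boolIndicator]
    exact hD w
  have h := hM w
  rw [hacc] at h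
  refine h.mono ?_
  show p.eval _ ≤ (p.comp (X + 3 * ((X + 1) ^ k + Polynomial.C k))).eval w.length
  have e : (p.comp (X + 3 * ((X + 1) ^ k + Polynomial.C k))).eval w.length
      = p.eval (w.length + 3 * ((w.length + 1) ^ k + k)) := by
    simp only [eval_comp, eval_add, eval_mul, eval_pow, eval_X, eval_C, eval_one, eval_ofNat]
  rw [e]
  have hv : (USim.eff w).length ≤ w.length + 1 := by rw [USim.length_eff]; omega
  have h1 : (USim.eff w).length ^ k ≤ (w.length + 1) ^ k := Nat.pow_le_pow_left hv k
  have h2 : w.length ^ k ≤ (w.length + 1) ^ k := Nat.pow_le_pow_left (Nat.le_succ _) k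
  have h3 := hSk (USim.eff w).length
  have h4 := hTk (USim.eff w).length
  have h5 := hTk w.length
  exact TM2Iter.eval_mono p (by omega)

end Summit.PneNP.PneNP.Theorems.SoloBlind
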